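/-
Copyright: the b2b-balaban T⁴-continuum CRUX team, row NE7b OWNER lineage `t4-ne7b-p1` (gen 146). Project licence.
-/
import Summits.QuantumFields.BalabanUV.T4Continuum.Spine.NE7b.SupInterpolatedFifthKernelEntry
import Summits.QuantumFields.BalabanUV.T4Continuum.Spine.NE7b.SupWeightedFifthOrderLettersFive

/-!
# THE ORDER-5 OUTPUT LETTER OF THE WEIGHTED CLASS MAP, SLOT `S` (SCOPING-d17 §F F18; file (743)).  (687) bounds every fifth `ψ`-derivative
# entry of the one-step effective action `W⁺(ψ) = −log∫e^{−U(·+ψ)}dμ_{AAᵀ}` (the display's `e_x`-derivative of (521)'s centred fourth cumulant)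
# by the interpolated majorant `M₅′(x,y,z,t,s)` — no support indicator, product decay; the slot letter `output_k5ϑ_s` sums `M₅′` against the
# full-graph weight `Π_{pairs}ϑ` with `s` fixed.  THIS FILE composes them: `Σ_{free} |∂⁵W⁺(x,y,z,t,s)|·Πϑ ≤` the slot bound — the weighted
# OUTPUT slot letter of the next class member's `K5⁺ := |∂⁵W⁺|` in role `s`, from the road's (687) hypotheses and the weighted-class letters
# of SCOPING-d17 §D∕§F ONLY — no support letter, no finite-range hypothesis: with (659)∕(666)∕(738) (profile letters = intrinsic × factor
# letters) THE WEIGHTED CLASS MAP CLOSES AT ORDER 5 up to the rate bookkeeping (R-d) (row NE7b, node U5c; (687) and the slot letter BY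
# NAME; [folklore]).

Cell `pub-balaban`, sub-cell `t4`, spine estimate NE7b (`T4WeightBudget.RelWeightBound`; the cell's OWN estimate — NOT PRINTED in
[Bałaban 1983–89], NOT PROVED).  Crux-route work under `Spine/NE7b/` by the row OWNER (`t4-ne7b-p1` gen 146, file (743)) under FREEZE
(0)'s crux-prover clause; NOTHING of Bałaban's is named as a Lean object, valued or asserted; no `T4Continuum/Support` leaf typed; no
`def`, no notation (statements WRITTEN OUT as printed by (687)); zero `sorry`.  Imports (BY NAME): (687), the slot-`s` assembly file.

WHAT IS PROVED ([folklore]): **`fifth_derivative_weighted_slot_s`**; toy.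

HONEST (what this is NOT).  The order-5 member of the class map in one role (the other roles are sibling files; the operator letter and the
packaging are later files); finite-torus Gaussian measure `μ_{AAᵀ}` with the road's regularisation; scalar skeleton ((A3), NC-NE7b-α
UNRULED); nothing of Bałaban's asserted.  BY-NAME EFFECT ON THE WALL: NONE.  NE7b NOT PRINTED ∕ NOT PROVED; spine PROVED 0∕9; rung (B)+1 — the
programme's measures remain FINITE-torus statements; NOT the mass gap, NOT Clay.  HONEST DEPENDENCY: continuum YM on T⁴ ⇐ BetaPertH ∧ nine
spine estimates (0∕9 proved); BetaPertH ⇐ (D1) ∧ (D4) ∧ CAP+tail; G-an2-4 gates asym, D1 and NE2∕3∕4.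
-/

set_option autoImplicit false
set_option maxSynthPendingDepth 4

noncomputable section

namespace Summit.QuantumFields.BalabanUV.T4Continuum.NE7b.SupWeightedFifthOrderOutputFive

open MeasureTheory ProbabilityTheory Finset Real Matrix
open scoped BigOperators Matrix
open SupInterpolatedFifthKernelEntry (interpolated_fifth_kernel_entry)
open SupWeightedFifthOrderLettersFive (output_k5ϑ_s)

variable {ι κ : Type} [Fintype ι] [DecidableEq ι] [Fintype κ] [DecidableEq κ]

variable {U : EuclideanSpace ℝ ι → ℝ} {U' : EuclideanSpace ℝ ι → EuclideanSpace ℝ ι →L[ℝ] ℝ}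
  {U'' : EuclideanSpace ℝ ι → EuclideanSpace ℝ ι →L[ℝ] EuclideanSpace ℝ ι →L[ℝ] ℝ}
  {U₃ : EuclideanSpace ℝ ι → EuclideanSpace ℝ ι →L[ℝ] EuclideanSpace ℝ ι →L[ℝ] EuclideanSpace ℝ ι →L[ℝ] ℝ}
  {U₄ : EuclideanSpace ℝ ι → EuclideanSpace ℝ ι →L[ℝ] EuclideanSpace ℝ ι →L[ℝ] EuclideanSpace ℝ ι →L[ℝ] EuclideanSpace ℝ ι →L[ℝ] ℝ}
  {U₅ : EuclideanSpace ℝ ι →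
    EuclideanSpace ℝ ι →L[ℝ] EuclideanSpace ℝ ι →L[ℝ] EuclideanSpace ℝ ι →L[ℝ] EuclideanSpace ℝ ι →L[ℝ] EuclideanSpace ℝ ι →L[ℝ] ℝ}
  {Hk : ι → ι → ℝ} {K3 : ι → ι → ι → ℝ} {K4 : ι → ι → ι → ι → ℝ} {K5 : ι → ι → ι → ι → ι → ℝ} {A : Matrix ι κ ℝ} {D : κ → κ → ℝ}
  {γop κ₀ κ₁ κ₂ κ₃ κ₄ κ₅ κ₅r a τ δ θp lam lamA αr αc hr hc k3r k3c k4r k4c k5r k5c γ dr dc dθ dθ' αθ βθ S S' S₁ n₃ : ℝ} {θ : κ → κ → ℝ}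
  {σ : ι → κ → ℝ} {ρ r r₁ : ι → ι → ℝ} {C3k C3h C4 C5 : ℝ}
  {ϑ ϑ₂ : ι → ι → ℝ} {αθc αg1m αg2m αg1c αk4m1 αk4m2 αk4m3 αk4c αk5m1 αk5m2 αk5m3 αk5m4 αk5c hrϑ hcϑ k3rϑ k3mϑ k3cϑ k5ϑ1 k5ϑ2 k5ϑ3 k5ϑ4
    k5ϑ5 G Θ8 S2 : ℝ}

set_option synthInstance.maxHeartbeats 200000 in
set_option maxHeartbeats 6000000 in
set_option maxRecDepth 4096 in
/-- **ORDER-5 OUTPUT LETTER OF THE WEIGHTED CLASS MAP, SLOT `s`**: the fifth `ψ`-derivative entries of the one-step effective action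
(the display bounded by `M₅′` in (687)) summed over the four free indices against the full-graph weight `Πϑ` obey the weighted slot letter
`output_k5ϑ_s` — from the road's (687) hypotheses and the weighted-class letters only. [folklore] -/
theorem fifth_derivative_weighted_slot_s [Nonempty κ] (hΓop : (γop • (1 : Matrix ι ι ℝ) - A * Aᵀ).PosSemidef) (Y : Finset ι) (hUd : ∀ φ : EuclideanSpace ℝ ι, HasFDerivAt U (U' φ) φ)
    (hU'd : ∀ φ : EuclideanSpace ℝ ι, HasFDerivAt U' (U'' φ) φ) (hU''d : ∀ φ : EuclideanSpace ℝ ι, HasFDerivAt U'' (U₃ φ) φ) (hU₃d : ∀ φ : EuclideanSpace ℝ ι, HasFDerivAt U₃ (U₄ φ) φ)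
    (hU₄d : ∀ φ : EuclideanSpace ℝ ι, HasFDerivAt U₄ (U₅ φ) φ) (hU₅c : Continuous U₅) (hκ₀ : 0 ≤ κ₀) (hκ₁ : 0 ≤ κ₁) (ha : 0 ≤ a) (hτ : 0 < τ) (hδ : 0 < δ) (hθ0 : 0 < θp) (hθ1 : θp < 1) (hκθ : (2 * κ₀ * (1 + τ) + 4 * δ) * γop ≤ θp)
    (hκθw : 2 * κ₀ * (1 + τ) * γop + 4 * δ ≤ θp) (hstab : ∀ φ : EuclideanSpace ℝ ι, -(κ₀ * ∑ x ∈ Y, φ x ^ 2) ≤ U φ) (hU'b : ∀ φ : EuclideanSpace ℝ ι, ‖U' φ‖ ≤ κ₁ * (a + ∑ x ∈ Y, φ x ^ 2))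
    (hU''b : ∀ φ : EuclideanSpace ℝ ι, ‖U'' φ‖ ≤ κ₂) (hU₃b : ∀ φ : EuclideanSpace ℝ ι, ‖U₃ φ‖ ≤ κ₃) (hU₄b : ∀ φ : EuclideanSpace ℝ ι, ‖U₄ φ‖ ≤ κ₄) (hU₅b : ∀ φ : EuclideanSpace ℝ ι, ‖U₅ φ‖ ≤ κ₅) (hlam : 0 ≤ lam)
    (hUsec : ∀ s : ℝ, 0 ≤ s → s ≤ 1 → ∀ a b : EuclideanSpace ℝ ι, U ((1 - s) • a + s • b) - lam / 2 * (s * (1 - s)) * ∑ i, (a i - b i) ^ 2 ≤ (1 - s) * U a + s * U b) (hρg : lam * γop < 1)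
    (hHk : ∀ (φ : EuclideanSpace ℝ ι) (x z : ι), |U'' φ (EuclideanSpace.single z (1 : ℝ)) (EuclideanSpace.single x (1 : ℝ))| ≤ Hk x z) (hHk0 : ∀ v u, 0 ≤ Hk v u)
    (hK3 : ∀ (φ : EuclideanSpace ℝ ι) (u x y : ι), |U₃ φ (EuclideanSpace.single u (1 : ℝ)) (EuclideanSpace.single x (1 : ℝ)) (EuclideanSpace.single y (1 : ℝ))| ≤ K3 x y u) (hK30 : ∀ x y u, 0 ≤ K3 x y u)
    (hK4 : ∀ (φ : EuclideanSpace ℝ ι) (u x y z : ι), |U₄ φ (EuclideanSpace.single u (1 : ℝ)) (EuclideanSpace.single x (1 : ℝ)) (EuclideanSpace.single y (1 : ℝ)) (EuclideanSpace.single z (1 : ℝ))| ≤ K4 x y z u)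
    (hK40 : ∀ x y z u, 0 ≤ K4 x y z u)
    (hK5 : ∀ (φ : EuclideanSpace ℝ ι) (u x y z t : ι), |U₅ φ (EuclideanSpace.single u (1 : ℝ)) (EuclideanSpace.single x (1 : ℝ)) (EuclideanSpace.single y (1 : ℝ)) (EuclideanSpace.single z (1 : ℝ))
      (EuclideanSpace.single t (1 : ℝ))| ≤ K5 x y z t u) (hhr : ∀ v, ∑ u, Hk v u ≤ hr) (ψ : EuclideanSpace ℝ ι) (hαr : ∀ u, ∑ w, |A u w| ≤ αr) (hαc : ∀ w, ∑ u, |A u w| ≤ αc)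
    (hlamA : ∀ x : κ, ∑ u, ∑ v, |A u x| * |A v x| * Hk v u ≤ lamA) (hlamA1 : lamA < 1) (hγ : αc * hr * αr / (1 - lamA) ≤ γ) (hγ1 : γ < 1) (hD : ∀ x y, 0 ≤ D x y)
    (hDC : ∀ x y, (if x = y then (1 : ℝ) else 0) + ∑ z, D x z * ((if y = z then 0 else ∑ u, ∑ v, |A u y| * |A v z| * Hk v u) / (1 - lamA)) ≤ D x y) (hθnn : ∀ z w, 0 ≤ θ z w) (hDθr : ∀ z, ∑ w, D z w * θ z w ≤ dθ) (hdθ : 0 ≤ dθ)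
    (hDθc : ∀ w, ∑ z, D z w * θ z w ≤ dθ') (hdθ' : 0 ≤ dθ') (hσ0 : ∀ x w, 0 ≤ σ x w) (hσθ : ∀ x z w, σ x w ≤ σ x z * θ z w) (hρ1 : ∀ x y, 1 ≤ ρ x y) (hρsymm : ∀ x y, ρ x y = ρ y x) (hρmul : ∀ x y z, ρ x z ≤ ρ x y * ρ y z)
    (hρσ : ∀ x y w, ρ x y ^ 8 ≤ σ x w * σ y w) (hr1 : ∀ x y, 1 ≤ r x y) (hrσ : ∀ x y w, r x y ^ 24 ≤ σ x w * σ y w) (haσ : ∀ v : ι, ∑ w, (∑ u, |A u w| * Hk v u) * σ v w ≤ αθ) (hβ : 0 ≤ βθ)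
    (haσ' : ∀ (v : ι) (w : κ), (∑ u, |A u w| * Hk v u) * σ v w ≤ βθ) (hgσ : ∀ p q : ι, ∑ w, (∑ u, |A u w| * K3 p q u) * σ p w ≤ αθ) (hgσ' : ∀ (p q : ι) (w : κ), (∑ u, |A u w| * K3 p q u) * σ p w ≤ βθ)
    (hkσ : ∀ p q o : ι, ∑ w, (∑ u, |A u w| * K4 p q o u) * σ p w ≤ αθ) (hkσ' : ∀ (p q o : ι) (w : κ), (∑ u, |A u w| * K4 p q o u) * σ p w ≤ βθ)
    (hC3k : 4 * Real.sqrt ((5 * ((κ₂ ^ 4 + κ₄ ^ 4) * γop ^ 2) / (1 - lam * γop) ^ 2) * (αθ * dθ * (βθ * dθ') / (1 - lamA))) ≤ C3k)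
    (hC3h : 4 * Real.sqrt ((5 * ((κ₂ ^ 4 + κ₃ ^ 4) * γop ^ 2) / (1 - lam * γop) ^ 2) * (αθ * dθ * (βθ * dθ') / (1 - lamA))) ≤ C3h)
    (hC4 :
      (4 * (αθ * dθ * (βθ * dθ') / (1 - lamA)) + 3 * (αθ * dθ * (βθ * dθ') / (1 - lamA)) ^ 2 + 4 * (5 * ((κ₂ ^ 4 + κ₃ ^ 4) * γop ^ 2) / (1 - lam * γop) ^ 2) + 4 * (50 * ((κ₂ ^ 6 + κ₃ ^ 6) * γop ^ 3) / (1 - lam * γop) ^ 3) + 2 *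
        (((5 * ((κ₂ ^ 4 + κ₃ ^ 4) * γop ^ 2) / (1 - lam * γop) ^ 2) + 1) / 2) * ((((5 * ((κ₂ ^ 4 + κ₃ ^ 4) * γop ^ 2) / (1 - lam * γop) ^ 2) + 1) / 2) + (5 * ((κ₂ ^ 4 + κ₃ ^ 4) * γop ^ 2) / (1 - lam * γop) ^ 2))) ≤ C4)
    (hC5 :
      ((4 * (αθ * dθ * (βθ * dθ') / (1 - lamA)) + 5 * (50 * (κ₂ ^ 6 * γop ^ 3) / (1 - lam * γop) ^ 3) + (((5 * (κ₂ ^ 4 * γop ^ 2) / (1 - lam * γop) ^ 2) + 1) / 2) * (5 * (κ₂ ^ 4 * γop ^ 2) / (1 - lam * γop) ^ 2) + 2 *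
          (αθ * dθ * (βθ * dθ') / (1 - lamA)) * ((((5 * (κ₂ ^ 4 * γop ^ 2) / (1 - lam * γop) ^ 2) + 1) / 2) + (5 * (κ₂ ^ 4 * γop ^ 2) / (1 - lam * γop) ^ 2)) + 24 * (((5 * (κ₂ ^ 4 * γop ^ 2) / (1 - lam * γop) ^ 2) + 1) / 2) *
          Real.sqrt ((αθ * dθ * (βθ * dθ') / (1 - lamA)) * (5 * (κ₂ ^ 4 * γop ^ 2) / (1 - lam * γop) ^ 2))) +
        (6 * (αθ * dθ * (βθ * dθ') / (1 - lamA)) + 5 * (50 * (κ₂ ^ 6 * γop ^ 3) / (1 - lam * γop) ^ 3) + ((((5 * (κ₂ ^ 4 * γop ^ 2) / (1 - lam * γop) ^ 2) + 1) / 2) + (5 * (κ₂ ^ 4 * γop ^ 2) / (1 - lam * γop) ^ 2)) ^ 2 / 2 + 3 *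
          (((5 * (κ₂ ^ 4 * γop ^ 2) / (1 - lam * γop) ^ 2) + 1) / 2) * (5 * (κ₂ ^ 4 * γop ^ 2) / (1 - lam * γop) ^ 2) + 3 * (αθ * dθ * (βθ * dθ') / (1 - lamA)) *
          ((((5 * (κ₂ ^ 4 * γop ^ 2) / (1 - lam * γop) ^ 2) + 1) / 2) + (5 * (κ₂ ^ 4 * γop ^ 2) / (1 - lam * γop) ^ 2)) + 12 * (((5 * (κ₂ ^ 4 * γop ^ 2) / (1 - lam * γop) ^ 2) + 1) / 2) * Real.sqrt
          ((αθ * dθ * (βθ * dθ') / (1 - lamA)) * (5 * (κ₂ ^ 4 * γop ^ 2) / (1 - lam * γop) ^ 2)))) ≤ C5) (hr₁1 : ∀ x y, 1 ≤ r₁ x y) (hr₁symm : ∀ x y, r₁ x y = r₁ y x) (hr₁mul : ∀ x y z, r₁ x z ≤ r₁ x y * r₁ y z)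
    (hr₁8 : ∀ x y, r₁ x y ^ 8 ≤ r x y) (hC40 : 0 ≤ C4) (hC50 : 0 ≤ C5)
    (hϑ1 : ∀ x y, 1 ≤ ϑ x y) (hϑsymm : ∀ x y, ϑ x y = ϑ y x) (hϑmul : ∀ x y z, ϑ x z ≤ ϑ x y * ϑ y z) (hϑ4 : ∀ x y, ϑ x y ^ 4 ≤ ϑ₂ x y) (hϑ₂symm : ∀ x y, ϑ₂ x y = ϑ₂ y x) (hϑσ6 : ∀ x y w, ϑ x y ^ 6 ≤ σ x w * σ y w)
        (hϑr₁ : ∀ x y, ϑ x y ≤ r₁ x y) (hG : ∀ a, ∑ b, ϑ a b ^ 6 / Real.sqrt (ρ a b) ≤ G) (hΘ : ∀ a, ∑ b, (ϑ a b ^ 4) ^ 2 / ϑ₂ a b ≤ Θ8) (hS2 : ∀ a, ∑ b, ϑ a b ^ 2 / r₁ a b ≤ S2) (hhrw : ∀ v, ∑ u, ϑ₂ v u * Hk v u ≤ hrϑ)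
        (hhc : ∀ a, ∑ b, ϑ₂ a b * Hk b a ≤ hcϑ) (hk3m : ∀ y, ∑ x, ∑ v, K3 x y v * (ϑ₂ y x * ϑ₂ y v * ϑ₂ x v) ≤ k3mϑ) (hk3c : ∀ v, ∑ y, ∑ z, K3 y z v * (ϑ₂ v y * ϑ₂ v z * ϑ₂ y z) ≤ k3cϑ)
        (hbσc : ∀ z', ∑ v, (∑ u, |A u z'| * Hk v u) * σ v z' ≤ αθc) (hαθc : 0 ≤ αθc) (hg2m : ∀ y, ∑ x, ϑ₂ y x * ∑ z', (∑ u, |A u z'| * K3 x y u) * σ y z' ≤ αg2m)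
        (hg1c : ∀ z', ∑ x, ∑ y, (∑ u, |A u z'| * K3 x y u) * (σ x z' * ϑ₂ x y) ≤ αg1c) (hαg1c : 0 ≤ αg1c) (hk4m3 : ∀ s, ∑ p, ∑ q, (ϑ₂ s p * ϑ₂ s q * ϑ₂ p q) * ∑ z', (∑ u, |A u z'| * K4 p q s u) * σ s z' ≤ αk4m3)
        (hk4c : ∀ z', ∑ a, ∑ b, ∑ c, (∑ u, |A u z'| * K4 a b c u) * (σ a z' * (ϑ₂ a b * ϑ₂ a c * ϑ₂ b c)) ≤ αk4c) (hαk4c : 0 ≤ αk4c)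
        (hk5m4 : ∀ s, ∑ a, ∑ b, ∑ c, (ϑ₂ s a * ϑ₂ s b * ϑ₂ s c * ϑ₂ a b * ϑ₂ a c * ϑ₂ b c) * ∑ z', (∑ u, |A u z'| * K5 a b c s u) * σ s z' ≤ αk5m4)
        (hk5c : ∀ z', ∑ a, ∑ b, ∑ c, ∑ d, (∑ u, |A u z'| * K5 a b c d u) * (σ a z' * (ϑ₂ a b * ϑ₂ a c * ϑ₂ a d * ϑ₂ b c * ϑ₂ b d * ϑ₂ c d)) ≤ αk5c) (hαk5c : 0 ≤ αk5c)
        (hk5 : ∀ s, ∑ x, ∑ y, ∑ z, ∑ t, K5 y z t s x * (ϑ₂ x y * ϑ₂ x z * ϑ₂ x t * ϑ₂ x s * ϑ₂ y z * ϑ₂ y t * ϑ₂ y s * ϑ₂ z t * ϑ₂ z s * ϑ₂ t s) ≤ k5ϑ4) (s : ι) :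
    ∑ x, ∑ y, ∑ z, ∑ t, |lineDeriv ℝ
        (fun ψ' : EuclideanSpace ℝ ι => (∫ ω : EuclideanSpace ℝ ι, exp (-U (ω + ψ')) ∂(multivariateGaussian 0 (A * Aᵀ)))⁻¹ *
          (∫ ω : EuclideanSpace ℝ ι, exp (-U (ω + ψ')) * U₄ (ω + ψ') (EuclideanSpace.single y (1 : ℝ)) (EuclideanSpace.single z (1 : ℝ)) (EuclideanSpace.single t (1 : ℝ)) (EuclideanSpace.single s (1 : ℝ))
            ∂(multivariateGaussian 0 (A * Aᵀ))) -
          (((∫ ω : EuclideanSpace ℝ ι, exp (-U (ω + ψ')) ∂(multivariateGaussian 0 (A * Aᵀ)))⁻¹ *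
              (∫ ω : EuclideanSpace ℝ ι, exp (-U (ω + ψ')) * (U₃ (ω + ψ') (EuclideanSpace.single y (1 : ℝ)) (EuclideanSpace.single t (1 : ℝ)) (EuclideanSpace.single s (1 : ℝ)) * U' (ω + ψ') (EuclideanSpace.single z (1 : ℝ)))
                ∂(multivariateGaussian 0 (A * Aᵀ))) - ((∫ ω : EuclideanSpace ℝ ι, exp (-U (ω + ψ')) ∂(multivariateGaussian 0 (A * Aᵀ))) ^ 2)⁻¹ *
              ((∫ ω : EuclideanSpace ℝ ι, exp (-U (ω + ψ')) * U₃ (ω + ψ') (EuclideanSpace.single y (1 : ℝ)) (EuclideanSpace.single t (1 : ℝ)) (EuclideanSpace.single s (1 : ℝ)) ∂(multivariateGaussian 0 (A * Aᵀ))) *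
                (∫ ω : EuclideanSpace ℝ ι, exp (-U (ω + ψ')) * U' (ω + ψ') (EuclideanSpace.single z (1 : ℝ)) ∂(multivariateGaussian 0 (A * Aᵀ))))) +
            ((∫ ω : EuclideanSpace ℝ ι, exp (-U (ω + ψ')) ∂(multivariateGaussian 0 (A * Aᵀ)))⁻¹ *
              (∫ ω : EuclideanSpace ℝ ι, exp (-U (ω + ψ')) * (U₃ (ω + ψ') (EuclideanSpace.single y (1 : ℝ)) (EuclideanSpace.single z (1 : ℝ)) (EuclideanSpace.single s (1 : ℝ)) * U' (ω + ψ') (EuclideanSpace.single t (1 : ℝ)))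
                ∂(multivariateGaussian 0 (A * Aᵀ))) - ((∫ ω : EuclideanSpace ℝ ι, exp (-U (ω + ψ')) ∂(multivariateGaussian 0 (A * Aᵀ))) ^ 2)⁻¹ *
              ((∫ ω : EuclideanSpace ℝ ι, exp (-U (ω + ψ')) * U₃ (ω + ψ') (EuclideanSpace.single y (1 : ℝ)) (EuclideanSpace.single z (1 : ℝ)) (EuclideanSpace.single s (1 : ℝ)) ∂(multivariateGaussian 0 (A * Aᵀ))) *
                (∫ ω : EuclideanSpace ℝ ι, exp (-U (ω + ψ')) * U' (ω + ψ') (EuclideanSpace.single t (1 : ℝ)) ∂(multivariateGaussian 0 (A * Aᵀ))))) +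
            ((∫ ω : EuclideanSpace ℝ ι, exp (-U (ω + ψ')) ∂(multivariateGaussian 0 (A * Aᵀ)))⁻¹ *
              (∫ ω : EuclideanSpace ℝ ι, exp (-U (ω + ψ')) * (U₃ (ω + ψ') (EuclideanSpace.single y (1 : ℝ)) (EuclideanSpace.single z (1 : ℝ)) (EuclideanSpace.single t (1 : ℝ)) * U' (ω + ψ') (EuclideanSpace.single s (1 : ℝ)))
                ∂(multivariateGaussian 0 (A * Aᵀ))) - ((∫ ω : EuclideanSpace ℝ ι, exp (-U (ω + ψ')) ∂(multivariateGaussian 0 (A * Aᵀ))) ^ 2)⁻¹ *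
              ((∫ ω : EuclideanSpace ℝ ι, exp (-U (ω + ψ')) * U₃ (ω + ψ') (EuclideanSpace.single y (1 : ℝ)) (EuclideanSpace.single z (1 : ℝ)) (EuclideanSpace.single t (1 : ℝ)) ∂(multivariateGaussian 0 (A * Aᵀ))) *
                (∫ ω : EuclideanSpace ℝ ι, exp (-U (ω + ψ')) * U' (ω + ψ') (EuclideanSpace.single s (1 : ℝ)) ∂(multivariateGaussian 0 (A * Aᵀ))))) +
            ((∫ ω : EuclideanSpace ℝ ι, exp (-U (ω + ψ')) ∂(multivariateGaussian 0 (A * Aᵀ)))⁻¹ *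
              (∫ ω : EuclideanSpace ℝ ι, exp (-U (ω + ψ')) * (U' (ω + ψ') (EuclideanSpace.single y (1 : ℝ)) * U₃ (ω + ψ') (EuclideanSpace.single z (1 : ℝ)) (EuclideanSpace.single t (1 : ℝ)) (EuclideanSpace.single s (1 : ℝ)))
                ∂(multivariateGaussian 0 (A * Aᵀ))) - ((∫ ω : EuclideanSpace ℝ ι, exp (-U (ω + ψ')) ∂(multivariateGaussian 0 (A * Aᵀ))) ^ 2)⁻¹ *
              ((∫ ω : EuclideanSpace ℝ ι, exp (-U (ω + ψ')) * U' (ω + ψ') (EuclideanSpace.single y (1 : ℝ)) ∂(multivariateGaussian 0 (A * Aᵀ))) *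
                (∫ ω : EuclideanSpace ℝ ι, exp (-U (ω + ψ')) * U₃ (ω + ψ') (EuclideanSpace.single z (1 : ℝ)) (EuclideanSpace.single t (1 : ℝ)) (EuclideanSpace.single s (1 : ℝ)) ∂(multivariateGaussian 0 (A * Aᵀ)))))) -
          (((∫ ω : EuclideanSpace ℝ ι, exp (-U (ω + ψ')) ∂(multivariateGaussian 0 (A * Aᵀ)))⁻¹ *
              (∫ ω : EuclideanSpace ℝ ι, exp (-U (ω + ψ')) * (U'' (ω + ψ') (EuclideanSpace.single y (1 : ℝ)) (EuclideanSpace.single z (1 : ℝ)) * U'' (ω + ψ') (EuclideanSpace.single t (1 : ℝ)) (EuclideanSpace.single s (1 : ℝ)))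
                ∂(multivariateGaussian 0 (A * Aᵀ))) - ((∫ ω : EuclideanSpace ℝ ι, exp (-U (ω + ψ')) ∂(multivariateGaussian 0 (A * Aᵀ))) ^ 2)⁻¹ *
              ((∫ ω : EuclideanSpace ℝ ι, exp (-U (ω + ψ')) * U'' (ω + ψ') (EuclideanSpace.single y (1 : ℝ)) (EuclideanSpace.single z (1 : ℝ)) ∂(multivariateGaussian 0 (A * Aᵀ))) *
                (∫ ω : EuclideanSpace ℝ ι, exp (-U (ω + ψ')) * U'' (ω + ψ') (EuclideanSpace.single t (1 : ℝ)) (EuclideanSpace.single s (1 : ℝ)) ∂(multivariateGaussian 0 (A * Aᵀ))))) +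
            ((∫ ω : EuclideanSpace ℝ ι, exp (-U (ω + ψ')) ∂(multivariateGaussian 0 (A * Aᵀ)))⁻¹ *
              (∫ ω : EuclideanSpace ℝ ι, exp (-U (ω + ψ')) * (U'' (ω + ψ') (EuclideanSpace.single y (1 : ℝ)) (EuclideanSpace.single t (1 : ℝ)) * U'' (ω + ψ') (EuclideanSpace.single z (1 : ℝ)) (EuclideanSpace.single s (1 : ℝ)))
                ∂(multivariateGaussian 0 (A * Aᵀ))) - ((∫ ω : EuclideanSpace ℝ ι, exp (-U (ω + ψ')) ∂(multivariateGaussian 0 (A * Aᵀ))) ^ 2)⁻¹ *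
              ((∫ ω : EuclideanSpace ℝ ι, exp (-U (ω + ψ')) * U'' (ω + ψ') (EuclideanSpace.single y (1 : ℝ)) (EuclideanSpace.single t (1 : ℝ)) ∂(multivariateGaussian 0 (A * Aᵀ))) *
                (∫ ω : EuclideanSpace ℝ ι, exp (-U (ω + ψ')) * U'' (ω + ψ') (EuclideanSpace.single z (1 : ℝ)) (EuclideanSpace.single s (1 : ℝ)) ∂(multivariateGaussian 0 (A * Aᵀ))))) +
            ((∫ ω : EuclideanSpace ℝ ι, exp (-U (ω + ψ')) ∂(multivariateGaussian 0 (A * Aᵀ)))⁻¹ *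
              (∫ ω : EuclideanSpace ℝ ι, exp (-U (ω + ψ')) * (U'' (ω + ψ') (EuclideanSpace.single y (1 : ℝ)) (EuclideanSpace.single s (1 : ℝ)) * U'' (ω + ψ') (EuclideanSpace.single z (1 : ℝ)) (EuclideanSpace.single t (1 : ℝ)))
                ∂(multivariateGaussian 0 (A * Aᵀ))) - ((∫ ω : EuclideanSpace ℝ ι, exp (-U (ω + ψ')) ∂(multivariateGaussian 0 (A * Aᵀ))) ^ 2)⁻¹ *
              ((∫ ω : EuclideanSpace ℝ ι, exp (-U (ω + ψ')) * U'' (ω + ψ') (EuclideanSpace.single y (1 : ℝ)) (EuclideanSpace.single s (1 : ℝ)) ∂(multivariateGaussian 0 (A * Aᵀ))) *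
                (∫ ω : EuclideanSpace ℝ ι, exp (-U (ω + ψ')) * U'' (ω + ψ') (EuclideanSpace.single z (1 : ℝ)) (EuclideanSpace.single t (1 : ℝ)) ∂(multivariateGaussian 0 (A * Aᵀ)))))) +
          ((∫ ω : EuclideanSpace ℝ ι, exp (-U (ω + ψ')) ∂(multivariateGaussian 0 (A * Aᵀ)))⁻¹ *
            (∫ ω : EuclideanSpace ℝ ι, exp (-U (ω + ψ')) *
              ((U'' (ω + ψ') (EuclideanSpace.single y (1 : ℝ)) (EuclideanSpace.single z (1 : ℝ)) -
                  ((∫ ω : EuclideanSpace ℝ ι, exp (-U (ω + ψ')) ∂(multivariateGaussian 0 (A * Aᵀ)))⁻¹ *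
                    (∫ ω : EuclideanSpace ℝ ι, exp (-U (ω + ψ')) * U'' (ω + ψ') (EuclideanSpace.single y (1 : ℝ)) (EuclideanSpace.single z (1 : ℝ)) ∂(multivariateGaussian 0 (A * Aᵀ))))) *
                (U' (ω + ψ') (EuclideanSpace.single t (1 : ℝ)) -
                  ((∫ ω : EuclideanSpace ℝ ι, exp (-U (ω + ψ')) ∂(multivariateGaussian 0 (A * Aᵀ)))⁻¹ *
                    (∫ ω : EuclideanSpace ℝ ι, exp (-U (ω + ψ')) * U' (ω + ψ') (EuclideanSpace.single t (1 : ℝ)) ∂(multivariateGaussian 0 (A * Aᵀ))))) *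
                (U' (ω + ψ') (EuclideanSpace.single s (1 : ℝ)) -
                  ((∫ ω : EuclideanSpace ℝ ι, exp (-U (ω + ψ')) ∂(multivariateGaussian 0 (A * Aᵀ)))⁻¹ *
                    (∫ ω : EuclideanSpace ℝ ι, exp (-U (ω + ψ')) * U' (ω + ψ') (EuclideanSpace.single s (1 : ℝ)) ∂(multivariateGaussian 0 (A * Aᵀ)))))) ∂(multivariateGaussian 0 (A * Aᵀ))) +
            (∫ ω : EuclideanSpace ℝ ι, exp (-U (ω + ψ')) ∂(multivariateGaussian 0 (A * Aᵀ)))⁻¹ *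
            (∫ ω : EuclideanSpace ℝ ι, exp (-U (ω + ψ')) *
              ((U'' (ω + ψ') (EuclideanSpace.single y (1 : ℝ)) (EuclideanSpace.single t (1 : ℝ)) -
                  ((∫ ω : EuclideanSpace ℝ ι, exp (-U (ω + ψ')) ∂(multivariateGaussian 0 (A * Aᵀ)))⁻¹ *
                    (∫ ω : EuclideanSpace ℝ ι, exp (-U (ω + ψ')) * U'' (ω + ψ') (EuclideanSpace.single y (1 : ℝ)) (EuclideanSpace.single t (1 : ℝ)) ∂(multivariateGaussian 0 (A * Aᵀ))))) *
                (U' (ω + ψ') (EuclideanSpace.single z (1 : ℝ)) -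
                  ((∫ ω : EuclideanSpace ℝ ι, exp (-U (ω + ψ')) ∂(multivariateGaussian 0 (A * Aᵀ)))⁻¹ *
                    (∫ ω : EuclideanSpace ℝ ι, exp (-U (ω + ψ')) * U' (ω + ψ') (EuclideanSpace.single z (1 : ℝ)) ∂(multivariateGaussian 0 (A * Aᵀ))))) *
                (U' (ω + ψ') (EuclideanSpace.single s (1 : ℝ)) -
                  ((∫ ω : EuclideanSpace ℝ ι, exp (-U (ω + ψ')) ∂(multivariateGaussian 0 (A * Aᵀ)))⁻¹ *
                    (∫ ω : EuclideanSpace ℝ ι, exp (-U (ω + ψ')) * U' (ω + ψ') (EuclideanSpace.single s (1 : ℝ)) ∂(multivariateGaussian 0 (A * Aᵀ)))))) ∂(multivariateGaussian 0 (A * Aᵀ))) +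
            (∫ ω : EuclideanSpace ℝ ι, exp (-U (ω + ψ')) ∂(multivariateGaussian 0 (A * Aᵀ)))⁻¹ *
            (∫ ω : EuclideanSpace ℝ ι, exp (-U (ω + ψ')) *
              ((U'' (ω + ψ') (EuclideanSpace.single y (1 : ℝ)) (EuclideanSpace.single s (1 : ℝ)) -
                  ((∫ ω : EuclideanSpace ℝ ι, exp (-U (ω + ψ')) ∂(multivariateGaussian 0 (A * Aᵀ)))⁻¹ *
                    (∫ ω : EuclideanSpace ℝ ι, exp (-U (ω + ψ')) * U'' (ω + ψ') (EuclideanSpace.single y (1 : ℝ)) (EuclideanSpace.single s (1 : ℝ)) ∂(multivariateGaussian 0 (A * Aᵀ))))) *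
                (U' (ω + ψ') (EuclideanSpace.single z (1 : ℝ)) -
                  ((∫ ω : EuclideanSpace ℝ ι, exp (-U (ω + ψ')) ∂(multivariateGaussian 0 (A * Aᵀ)))⁻¹ *
                    (∫ ω : EuclideanSpace ℝ ι, exp (-U (ω + ψ')) * U' (ω + ψ') (EuclideanSpace.single z (1 : ℝ)) ∂(multivariateGaussian 0 (A * Aᵀ))))) *
                (U' (ω + ψ') (EuclideanSpace.single t (1 : ℝ)) -
                  ((∫ ω : EuclideanSpace ℝ ι, exp (-U (ω + ψ')) ∂(multivariateGaussian 0 (A * Aᵀ)))⁻¹ *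
                    (∫ ω : EuclideanSpace ℝ ι, exp (-U (ω + ψ')) * U' (ω + ψ') (EuclideanSpace.single t (1 : ℝ)) ∂(multivariateGaussian 0 (A * Aᵀ)))))) ∂(multivariateGaussian 0 (A * Aᵀ))) +
            (∫ ω : EuclideanSpace ℝ ι, exp (-U (ω + ψ')) ∂(multivariateGaussian 0 (A * Aᵀ)))⁻¹ *
            (∫ ω : EuclideanSpace ℝ ι, exp (-U (ω + ψ')) *
              ((U' (ω + ψ') (EuclideanSpace.single y (1 : ℝ)) -
                  ((∫ ω : EuclideanSpace ℝ ι, exp (-U (ω + ψ')) ∂(multivariateGaussian 0 (A * Aᵀ)))⁻¹ *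
                    (∫ ω : EuclideanSpace ℝ ι, exp (-U (ω + ψ')) * U' (ω + ψ') (EuclideanSpace.single y (1 : ℝ)) ∂(multivariateGaussian 0 (A * Aᵀ))))) *
                (U'' (ω + ψ') (EuclideanSpace.single z (1 : ℝ)) (EuclideanSpace.single t (1 : ℝ)) -
                  ((∫ ω : EuclideanSpace ℝ ι, exp (-U (ω + ψ')) ∂(multivariateGaussian 0 (A * Aᵀ)))⁻¹ *
                    (∫ ω : EuclideanSpace ℝ ι, exp (-U (ω + ψ')) * U'' (ω + ψ') (EuclideanSpace.single z (1 : ℝ)) (EuclideanSpace.single t (1 : ℝ)) ∂(multivariateGaussian 0 (A * Aᵀ))))) *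
                (U' (ω + ψ') (EuclideanSpace.single s (1 : ℝ)) -
                  ((∫ ω : EuclideanSpace ℝ ι, exp (-U (ω + ψ')) ∂(multivariateGaussian 0 (A * Aᵀ)))⁻¹ *
                    (∫ ω : EuclideanSpace ℝ ι, exp (-U (ω + ψ')) * U' (ω + ψ') (EuclideanSpace.single s (1 : ℝ)) ∂(multivariateGaussian 0 (A * Aᵀ)))))) ∂(multivariateGaussian 0 (A * Aᵀ))) +
            (∫ ω : EuclideanSpace ℝ ι, exp (-U (ω + ψ')) ∂(multivariateGaussian 0 (A * Aᵀ)))⁻¹ *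
            (∫ ω : EuclideanSpace ℝ ι, exp (-U (ω + ψ')) *
              ((U' (ω + ψ') (EuclideanSpace.single y (1 : ℝ)) -
                  ((∫ ω : EuclideanSpace ℝ ι, exp (-U (ω + ψ')) ∂(multivariateGaussian 0 (A * Aᵀ)))⁻¹ *
                    (∫ ω : EuclideanSpace ℝ ι, exp (-U (ω + ψ')) * U' (ω + ψ') (EuclideanSpace.single y (1 : ℝ)) ∂(multivariateGaussian 0 (A * Aᵀ))))) *
                (U'' (ω + ψ') (EuclideanSpace.single z (1 : ℝ)) (EuclideanSpace.single s (1 : ℝ)) -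
                  ((∫ ω : EuclideanSpace ℝ ι, exp (-U (ω + ψ')) ∂(multivariateGaussian 0 (A * Aᵀ)))⁻¹ *
                    (∫ ω : EuclideanSpace ℝ ι, exp (-U (ω + ψ')) * U'' (ω + ψ') (EuclideanSpace.single z (1 : ℝ)) (EuclideanSpace.single s (1 : ℝ)) ∂(multivariateGaussian 0 (A * Aᵀ))))) *
                (U' (ω + ψ') (EuclideanSpace.single t (1 : ℝ)) -
                  ((∫ ω : EuclideanSpace ℝ ι, exp (-U (ω + ψ')) ∂(multivariateGaussian 0 (A * Aᵀ)))⁻¹ *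
                    (∫ ω : EuclideanSpace ℝ ι, exp (-U (ω + ψ')) * U' (ω + ψ') (EuclideanSpace.single t (1 : ℝ)) ∂(multivariateGaussian 0 (A * Aᵀ)))))) ∂(multivariateGaussian 0 (A * Aᵀ))) +
            (∫ ω : EuclideanSpace ℝ ι, exp (-U (ω + ψ')) ∂(multivariateGaussian 0 (A * Aᵀ)))⁻¹ *
            (∫ ω : EuclideanSpace ℝ ι, exp (-U (ω + ψ')) *
              ((U' (ω + ψ') (EuclideanSpace.single y (1 : ℝ)) -
                  ((∫ ω : EuclideanSpace ℝ ι, exp (-U (ω + ψ')) ∂(multivariateGaussian 0 (A * Aᵀ)))⁻¹ *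
                    (∫ ω : EuclideanSpace ℝ ι, exp (-U (ω + ψ')) * U' (ω + ψ') (EuclideanSpace.single y (1 : ℝ)) ∂(multivariateGaussian 0 (A * Aᵀ))))) *
                (U'' (ω + ψ') (EuclideanSpace.single t (1 : ℝ)) (EuclideanSpace.single s (1 : ℝ)) -
                  ((∫ ω : EuclideanSpace ℝ ι, exp (-U (ω + ψ')) ∂(multivariateGaussian 0 (A * Aᵀ)))⁻¹ *
                    (∫ ω : EuclideanSpace ℝ ι, exp (-U (ω + ψ')) * U'' (ω + ψ') (EuclideanSpace.single t (1 : ℝ)) (EuclideanSpace.single s (1 : ℝ)) ∂(multivariateGaussian 0 (A * Aᵀ))))) *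
                (U' (ω + ψ') (EuclideanSpace.single z (1 : ℝ)) -
                  ((∫ ω : EuclideanSpace ℝ ι, exp (-U (ω + ψ')) ∂(multivariateGaussian 0 (A * Aᵀ)))⁻¹ *
                    (∫ ω : EuclideanSpace ℝ ι, exp (-U (ω + ψ')) * U' (ω + ψ') (EuclideanSpace.single z (1 : ℝ)) ∂(multivariateGaussian 0 (A * Aᵀ)))))) ∂(multivariateGaussian 0 (A * Aᵀ)))) -
          ((∫ ω : EuclideanSpace ℝ ι, exp (-U (ω + ψ')) ∂(multivariateGaussian 0 (A * Aᵀ)))⁻¹ *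
            (∫ ω : EuclideanSpace ℝ ι, exp (-U (ω + ψ')) *
              ((U' (ω + ψ') (EuclideanSpace.single y (1 : ℝ)) -
                  ((∫ ω : EuclideanSpace ℝ ι, exp (-U (ω + ψ')) ∂(multivariateGaussian 0 (A * Aᵀ)))⁻¹ *
                    (∫ ω : EuclideanSpace ℝ ι, exp (-U (ω + ψ')) * U' (ω + ψ') (EuclideanSpace.single y (1 : ℝ)) ∂(multivariateGaussian 0 (A * Aᵀ))))) *
                (U' (ω + ψ') (EuclideanSpace.single z (1 : ℝ)) -
                  ((∫ ω : EuclideanSpace ℝ ι, exp (-U (ω + ψ')) ∂(multivariateGaussian 0 (A * Aᵀ)))⁻¹ *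
                    (∫ ω : EuclideanSpace ℝ ι, exp (-U (ω + ψ')) * U' (ω + ψ') (EuclideanSpace.single z (1 : ℝ)) ∂(multivariateGaussian 0 (A * Aᵀ))))) *
                (U' (ω + ψ') (EuclideanSpace.single t (1 : ℝ)) -
                  ((∫ ω : EuclideanSpace ℝ ι, exp (-U (ω + ψ')) ∂(multivariateGaussian 0 (A * Aᵀ)))⁻¹ *
                    (∫ ω : EuclideanSpace ℝ ι, exp (-U (ω + ψ')) * U' (ω + ψ') (EuclideanSpace.single t (1 : ℝ)) ∂(multivariateGaussian 0 (A * Aᵀ))))) *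
                (U' (ω + ψ') (EuclideanSpace.single s (1 : ℝ)) -
                  ((∫ ω : EuclideanSpace ℝ ι, exp (-U (ω + ψ')) ∂(multivariateGaussian 0 (A * Aᵀ)))⁻¹ *
                    (∫ ω : EuclideanSpace ℝ ι, exp (-U (ω + ψ')) * U' (ω + ψ') (EuclideanSpace.single s (1 : ℝ)) ∂(multivariateGaussian 0 (A * Aᵀ)))))) ∂(multivariateGaussian 0 (A * Aᵀ))) -
            ((∫ ω : EuclideanSpace ℝ ι, exp (-U (ω + ψ')) ∂(multivariateGaussian 0 (A * Aᵀ)))⁻¹ *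
              (∫ ω : EuclideanSpace ℝ ι, exp (-U (ω + ψ')) *
                ((U' (ω + ψ') (EuclideanSpace.single y (1 : ℝ)) -
                    ((∫ ω : EuclideanSpace ℝ ι, exp (-U (ω + ψ')) ∂(multivariateGaussian 0 (A * Aᵀ)))⁻¹ *
                      (∫ ω : EuclideanSpace ℝ ι, exp (-U (ω + ψ')) * U' (ω + ψ') (EuclideanSpace.single y (1 : ℝ)) ∂(multivariateGaussian 0 (A * Aᵀ))))) *
                  (U' (ω + ψ') (EuclideanSpace.single z (1 : ℝ)) -
                    ((∫ ω : EuclideanSpace ℝ ι, exp (-U (ω + ψ')) ∂(multivariateGaussian 0 (A * Aᵀ)))⁻¹ *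
                      (∫ ω : EuclideanSpace ℝ ι, exp (-U (ω + ψ')) * U' (ω + ψ') (EuclideanSpace.single z (1 : ℝ)) ∂(multivariateGaussian 0 (A * Aᵀ)))))) ∂(multivariateGaussian 0 (A * Aᵀ)))) *
            ((∫ ω : EuclideanSpace ℝ ι, exp (-U (ω + ψ')) ∂(multivariateGaussian 0 (A * Aᵀ)))⁻¹ *
              (∫ ω : EuclideanSpace ℝ ι, exp (-U (ω + ψ')) *
                ((U' (ω + ψ') (EuclideanSpace.single t (1 : ℝ)) -
                    ((∫ ω : EuclideanSpace ℝ ι, exp (-U (ω + ψ')) ∂(multivariateGaussian 0 (A * Aᵀ)))⁻¹ *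
                      (∫ ω : EuclideanSpace ℝ ι, exp (-U (ω + ψ')) * U' (ω + ψ') (EuclideanSpace.single t (1 : ℝ)) ∂(multivariateGaussian 0 (A * Aᵀ))))) *
                  (U' (ω + ψ') (EuclideanSpace.single s (1 : ℝ)) -
                    ((∫ ω : EuclideanSpace ℝ ι, exp (-U (ω + ψ')) ∂(multivariateGaussian 0 (A * Aᵀ)))⁻¹ *
                      (∫ ω : EuclideanSpace ℝ ι, exp (-U (ω + ψ')) * U' (ω + ψ') (EuclideanSpace.single s (1 : ℝ)) ∂(multivariateGaussian 0 (A * Aᵀ)))))) ∂(multivariateGaussian 0 (A * Aᵀ)))) -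
            ((∫ ω : EuclideanSpace ℝ ι, exp (-U (ω + ψ')) ∂(multivariateGaussian 0 (A * Aᵀ)))⁻¹ *
              (∫ ω : EuclideanSpace ℝ ι, exp (-U (ω + ψ')) *
                ((U' (ω + ψ') (EuclideanSpace.single y (1 : ℝ)) -
                    ((∫ ω : EuclideanSpace ℝ ι, exp (-U (ω + ψ')) ∂(multivariateGaussian 0 (A * Aᵀ)))⁻¹ *
                      (∫ ω : EuclideanSpace ℝ ι, exp (-U (ω + ψ')) * U' (ω + ψ') (EuclideanSpace.single y (1 : ℝ)) ∂(multivariateGaussian 0 (A * Aᵀ))))) *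
                  (U' (ω + ψ') (EuclideanSpace.single t (1 : ℝ)) -
                    ((∫ ω : EuclideanSpace ℝ ι, exp (-U (ω + ψ')) ∂(multivariateGaussian 0 (A * Aᵀ)))⁻¹ *
                      (∫ ω : EuclideanSpace ℝ ι, exp (-U (ω + ψ')) * U' (ω + ψ') (EuclideanSpace.single t (1 : ℝ)) ∂(multivariateGaussian 0 (A * Aᵀ)))))) ∂(multivariateGaussian 0 (A * Aᵀ)))) *
            ((∫ ω : EuclideanSpace ℝ ι, exp (-U (ω + ψ')) ∂(multivariateGaussian 0 (A * Aᵀ)))⁻¹ *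
              (∫ ω : EuclideanSpace ℝ ι, exp (-U (ω + ψ')) *
                ((U' (ω + ψ') (EuclideanSpace.single z (1 : ℝ)) -
                    ((∫ ω : EuclideanSpace ℝ ι, exp (-U (ω + ψ')) ∂(multivariateGaussian 0 (A * Aᵀ)))⁻¹ *
                      (∫ ω : EuclideanSpace ℝ ι, exp (-U (ω + ψ')) * U' (ω + ψ') (EuclideanSpace.single z (1 : ℝ)) ∂(multivariateGaussian 0 (A * Aᵀ))))) *
                  (U' (ω + ψ') (EuclideanSpace.single s (1 : ℝ)) -
                    ((∫ ω : EuclideanSpace ℝ ι, exp (-U (ω + ψ')) ∂(multivariateGaussian 0 (A * Aᵀ)))⁻¹ *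
                      (∫ ω : EuclideanSpace ℝ ι, exp (-U (ω + ψ')) * U' (ω + ψ') (EuclideanSpace.single s (1 : ℝ)) ∂(multivariateGaussian 0 (A * Aᵀ)))))) ∂(multivariateGaussian 0 (A * Aᵀ)))) -
            ((∫ ω : EuclideanSpace ℝ ι, exp (-U (ω + ψ')) ∂(multivariateGaussian 0 (A * Aᵀ)))⁻¹ *
              (∫ ω : EuclideanSpace ℝ ι, exp (-U (ω + ψ')) *
                ((U' (ω + ψ') (EuclideanSpace.single y (1 : ℝ)) -
                    ((∫ ω : EuclideanSpace ℝ ι, exp (-U (ω + ψ')) ∂(multivariateGaussian 0 (A * Aᵀ)))⁻¹ *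
                      (∫ ω : EuclideanSpace ℝ ι, exp (-U (ω + ψ')) * U' (ω + ψ') (EuclideanSpace.single y (1 : ℝ)) ∂(multivariateGaussian 0 (A * Aᵀ))))) *
                  (U' (ω + ψ') (EuclideanSpace.single s (1 : ℝ)) -
                    ((∫ ω : EuclideanSpace ℝ ι, exp (-U (ω + ψ')) ∂(multivariateGaussian 0 (A * Aᵀ)))⁻¹ *
                      (∫ ω : EuclideanSpace ℝ ι, exp (-U (ω + ψ')) * U' (ω + ψ') (EuclideanSpace.single s (1 : ℝ)) ∂(multivariateGaussian 0 (A * Aᵀ)))))) ∂(multivariateGaussian 0 (A * Aᵀ)))) *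
            ((∫ ω : EuclideanSpace ℝ ι, exp (-U (ω + ψ')) ∂(multivariateGaussian 0 (A * Aᵀ)))⁻¹ *
              (∫ ω : EuclideanSpace ℝ ι, exp (-U (ω + ψ')) *
                ((U' (ω + ψ') (EuclideanSpace.single z (1 : ℝ)) -
                    ((∫ ω : EuclideanSpace ℝ ι, exp (-U (ω + ψ')) ∂(multivariateGaussian 0 (A * Aᵀ)))⁻¹ *
                      (∫ ω : EuclideanSpace ℝ ι, exp (-U (ω + ψ')) * U' (ω + ψ') (EuclideanSpace.single z (1 : ℝ)) ∂(multivariateGaussian 0 (A * Aᵀ))))) *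
                  (U' (ω + ψ') (EuclideanSpace.single t (1 : ℝ)) -
                    ((∫ ω : EuclideanSpace ℝ ι, exp (-U (ω + ψ')) ∂(multivariateGaussian 0 (A * Aᵀ)))⁻¹ *
                      (∫ ω : EuclideanSpace ℝ ι, exp (-U (ω + ψ')) * U' (ω + ψ') (EuclideanSpace.single t (1 : ℝ)) ∂(multivariateGaussian 0 (A * Aᵀ)))))) ∂(multivariateGaussian 0 (A * Aᵀ)))))) ψ (EuclideanSpace.single x (1 : ℝ))|
        * (ϑ x y * ϑ x z * ϑ x t * ϑ x s * ϑ y z * ϑ y t * ϑ y s * ϑ z t * ϑ z s * ϑ t s) ≤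
      (k5ϑ4 + dθ * αk5m4 * (dθ' * αθc) / (1 - lamA) + dθ * αk5m4 * (dθ' * αθc) / (1 - lamA) + dθ * αk4m3 * (dθ' * αg1c) / (1 - lamA) + Real.sqrt (2 * Real.sqrt (5 * (κ₂ ^ 4 * γop ^ 2) / (1 - lam * γop) ^ 2) * C3k) *
            (Real.sqrt (k3mϑ * (Θ8 * Θ8)) * (G * G)) + dθ * αk5m4 * (dθ' * αθc) / (1 - lamA) + dθ * αk4m3 * (dθ' * αg1c) / (1 - lamA) + Real.sqrt (2 * Real.sqrt (5 * (κ₂ ^ 4 * γop ^ 2) / (1 - lam * γop) ^ 2) * C3k) *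
            (Real.sqrt (k3mϑ * (Θ8 * Θ8)) * (G * G)) + dθ * αθ * (dθ' * αk5c) / (1 - lamA)) +
          (dθ * αg2m * (dθ' * αk4c) / (1 - lamA) + Real.sqrt (2 * Real.sqrt (5 * (κ₂ ^ 4 * γop ^ 2) / (1 - lam * γop) ^ 2) * C3k) * (G * (G * Real.sqrt (k3cϑ * (Θ8 * Θ8)))) + dθ * αk4m3 * (dθ' * αg1c) / (1 - lamA) + dθ * αk5m4 *
            (dθ' * αθc) / (1 - lamA) + Real.sqrt (2 * Real.sqrt (5 * (κ₂ ^ 4 * γop ^ 2) / (1 - lam * γop) ^ 2) * C3k) * (Real.sqrt (k3mϑ * (Θ8 * Θ8)) * (G * G)) + dθ * αg2m * (dθ' * αk4c) / (1 - lamA) + dθ * αk4m3 * (dθ' * αg1c) /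
            (1 - lamA) + Real.sqrt (4 * Real.sqrt (Real.sqrt (5 * (κ₂ ^ 4 * γop ^ 2) / (1 - lam * γop) ^ 2)) * C3h) * (Real.sqrt (hrϑ * Θ8) * (G * (G * Real.sqrt (hcϑ * Θ8))))) +
          (dθ * αg2m * (dθ' * αk4c) / (1 - lamA) + dθ * αk4m3 * (dθ' * αg1c) / (1 - lamA) + Real.sqrt (4 * Real.sqrt (Real.sqrt (5 * (κ₂ ^ 4 * γop ^ 2) / (1 - lam * γop) ^ 2)) * C3h) *
            (Real.sqrt (hrϑ * Θ8) * (G * (G * Real.sqrt (hcϑ * Θ8)))) + dθ * αk4m3 * (dθ' * αg1c) / (1 - lamA) + dθ * αg2m * (dθ' * αk4c) / (1 - lamA) + Real.sqrt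
            (4 * Real.sqrt (Real.sqrt (5 * (κ₂ ^ 4 * γop ^ 2) / (1 - lam * γop) ^ 2)) * C3h) * (Real.sqrt (hrϑ * Θ8) * (G * (G * Real.sqrt (hcϑ * Θ8)))) + Real.sqrt
            (2 * Real.sqrt (5 * (κ₂ ^ 4 * γop ^ 2) / (1 - lam * γop) ^ 2) * C3k) * (G * (G * Real.sqrt (k3cϑ * (Θ8 * Θ8)))) + Real.sqrt (4 * Real.sqrt (Real.sqrt (5 * (κ₂ ^ 4 * γop ^ 2) / (1 - lam * γop) ^ 2)) * C3h) *
            (G * (G * (Real.sqrt (hcϑ * Θ8) * Real.sqrt (hcϑ * Θ8))))) +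
          (Real.sqrt (4 * Real.sqrt (Real.sqrt (5 * (κ₂ ^ 4 * γop ^ 2) / (1 - lam * γop) ^ 2)) * C3h) * (Real.sqrt (hrϑ * Θ8) * (G * (G * Real.sqrt (hcϑ * Θ8)))) + Real.sqrt
            (16 * (8 * (Real.sqrt (5 * (κ₂ ^ 4 * γop ^ 2) / (1 - lam * γop) ^ 2) * Real.sqrt (Real.sqrt (5 * (κ₂ ^ 4 * γop ^ 2) / (1 - lam * γop) ^ 2))) * C4)) * (S2 * (S2 * (Real.sqrt (hcϑ * Θ8) * S2))) + Real.sqrt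
            (2 * Real.sqrt (5 * (κ₂ ^ 4 * γop ^ 2) / (1 - lam * γop) ^ 2) * C3k) * (G * (G * Real.sqrt (k3cϑ * (Θ8 * Θ8)))) + Real.sqrt (4 * Real.sqrt (Real.sqrt (5 * (κ₂ ^ 4 * γop ^ 2) / (1 - lam * γop) ^ 2)) * C3h) *
            (G * (G * (Real.sqrt (hcϑ * Θ8) * Real.sqrt (hcϑ * Θ8)))) + Real.sqrt (4 * Real.sqrt (Real.sqrt (5 * (κ₂ ^ 4 * γop ^ 2) / (1 - lam * γop) ^ 2)) * C3h) * (Real.sqrt (hrϑ * Θ8) * (G * (G * Real.sqrt (hcϑ * Θ8)))) +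
            Real.sqrt (16 * (8 * (Real.sqrt (5 * (κ₂ ^ 4 * γop ^ 2) / (1 - lam * γop) ^ 2) * Real.sqrt (Real.sqrt (5 * (κ₂ ^ 4 * γop ^ 2) / (1 - lam * γop) ^ 2))) * C4)) * (S2 * (S2 * (S2 * Real.sqrt (hcϑ * Θ8)))) + Real.sqrt
            (2 * Real.sqrt (5 * (κ₂ ^ 4 * γop ^ 2) / (1 - lam * γop) ^ 2) * C3k) * (Real.sqrt (k3mϑ * (Θ8 * Θ8)) * (G * G))) +
          (Real.sqrt (4 * Real.sqrt (Real.sqrt (5 * (κ₂ ^ 4 * γop ^ 2) / (1 - lam * γop) ^ 2)) * C3h) * (Real.sqrt (hrϑ * Θ8) * (G * (Real.sqrt (hcϑ * Θ8) * G))) + Real.sqrt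
            (4 * Real.sqrt (Real.sqrt (5 * (κ₂ ^ 4 * γop ^ 2) / (1 - lam * γop) ^ 2)) * C3h) * (Real.sqrt (hrϑ * Θ8) * (G * (G * Real.sqrt (hcϑ * Θ8)))) + Real.sqrt
            (16 * (8 * (Real.sqrt (5 * (κ₂ ^ 4 * γop ^ 2) / (1 - lam * γop) ^ 2) * Real.sqrt (Real.sqrt (5 * (κ₂ ^ 4 * γop ^ 2) / (1 - lam * γop) ^ 2))) * C4)) * (Real.sqrt (hrϑ * Θ8) * (S2 * (S2 * S2))) + Real.sqrt
            (4 * Real.sqrt (Real.sqrt (5 * (κ₂ ^ 4 * γop ^ 2) / (1 - lam * γop) ^ 2)) * C3h) * (G * (Real.sqrt (hcϑ * Θ8) * (G * Real.sqrt (hcϑ * Θ8)))) + Real.sqrt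
            (2 * Real.sqrt (5 * (κ₂ ^ 4 * γop ^ 2) / (1 - lam * γop) ^ 2) * C3k) * (G * (G * Real.sqrt (k3cϑ * (Θ8 * Θ8)))) + Real.sqrt (4 * Real.sqrt (Real.sqrt (5 * (κ₂ ^ 4 * γop ^ 2) / (1 - lam * γop) ^ 2)) * C3h) *
            (Real.sqrt (hrϑ * Θ8) * (G * (G * Real.sqrt (hcϑ * Θ8)))) + Real.sqrt (16 * (8 * (Real.sqrt (5 * (κ₂ ^ 4 * γop ^ 2) / (1 - lam * γop) ^ 2) * Real.sqrt (Real.sqrt (5 * (κ₂ ^ 4 * γop ^ 2) / (1 - lam * γop) ^ 2))) * C4))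
            * (S2 * (S2 * (S2 * Real.sqrt (hcϑ * Θ8))))) +
          (Real.sqrt (4 * Real.sqrt (Real.sqrt (5 * (κ₂ ^ 4 * γop ^ 2) / (1 - lam * γop) ^ 2)) * C3h) * (Real.sqrt (hrϑ * Θ8) * (G * (Real.sqrt (hcϑ * Θ8) * G))) + Real.sqrt
            (2 * Real.sqrt (5 * (κ₂ ^ 4 * γop ^ 2) / (1 - lam * γop) ^ 2) * C3k) * (Real.sqrt (k3mϑ * (Θ8 * Θ8)) * (G * G)) + Real.sqrt (4 * Real.sqrt (Real.sqrt (5 * (κ₂ ^ 4 * γop ^ 2) / (1 - lam * γop) ^ 2)) * C3h) *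
            (Real.sqrt (hrϑ * Θ8) * (G * (G * Real.sqrt (hcϑ * Θ8)))) + Real.sqrt (16 * (8 * (Real.sqrt (5 * (κ₂ ^ 4 * γop ^ 2) / (1 - lam * γop) ^ 2) * Real.sqrt (Real.sqrt (5 * (κ₂ ^ 4 * γop ^ 2) / (1 - lam * γop) ^ 2))) * C4))
            * (Real.sqrt (hrϑ * Θ8) * (S2 * (S2 * S2))) + Real.sqrt (4 * Real.sqrt (Real.sqrt (5 * (κ₂ ^ 4 * γop ^ 2) / (1 - lam * γop) ^ 2)) * C3h) * (Real.sqrt (hrϑ * Θ8) * (G * (Real.sqrt (hcϑ * Θ8) * G))) + Real.sqrt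
            (2 * Real.sqrt (5 * (κ₂ ^ 4 * γop ^ 2) / (1 - lam * γop) ^ 2) * C3k) * (Real.sqrt (k3mϑ * (Θ8 * Θ8)) * (G * G)) + Real.sqrt (4 * Real.sqrt (Real.sqrt (5 * (κ₂ ^ 4 * γop ^ 2) / (1 - lam * γop) ^ 2)) * C3h) *
            (Real.sqrt (hrϑ * Θ8) * (G * (G * Real.sqrt (hcϑ * Θ8))))) +
          (Real.sqrt (16 * (8 * (Real.sqrt (5 * (κ₂ ^ 4 * γop ^ 2) / (1 - lam * γop) ^ 2) * Real.sqrt (Real.sqrt (5 * (κ₂ ^ 4 * γop ^ 2) / (1 - lam * γop) ^ 2))) * C4)) * (Real.sqrt (hrϑ * Θ8) * (S2 * (S2 * S2))) + Real.sqrt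
            (16 * (8 * (Real.sqrt (5 * (κ₂ ^ 4 * γop ^ 2) / (1 - lam * γop) ^ 2) * Real.sqrt (Real.sqrt (5 * (κ₂ ^ 4 * γop ^ 2) / (1 - lam * γop) ^ 2))) * C4)) * (S2 * (Real.sqrt (hcϑ * Θ8) * (S2 * S2))) + Real.sqrt
            (16 * (8 * (Real.sqrt (5 * (κ₂ ^ 4 * γop ^ 2) / (1 - lam * γop) ^ 2) * Real.sqrt (Real.sqrt (5 * (κ₂ ^ 4 * γop ^ 2) / (1 - lam * γop) ^ 2))) * C4)) * (S2 * (S2 * (Real.sqrt (hcϑ * Θ8) * S2))) + Real.sqrt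
            (16 * (8 * (Real.sqrt (5 * (κ₂ ^ 4 * γop ^ 2) / (1 - lam * γop) ^ 2) * Real.sqrt (Real.sqrt (5 * (κ₂ ^ 4 * γop ^ 2) / (1 - lam * γop) ^ 2))) * C4)) * (S2 * (S2 * (S2 * Real.sqrt (hcϑ * Θ8)))) + Real.sqrt
            (16 * (8 * (Real.sqrt (5 * (κ₂ ^ 4 * γop ^ 2) / (1 - lam * γop) ^ 2) * Real.sqrt (Real.sqrt (5 * (κ₂ ^ 4 * γop ^ 2) / (1 - lam * γop) ^ 2))) * C4)) * (Real.sqrt (hrϑ * Θ8) * (S2 * (S2 * S2)))) +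
          (C5 * (S2 * (S2 * (S2 * S2)))) := by
  have hK50d : ∀ a b c d u, 0 ≤ K5 a b c d u := fun a b c d u => (abs_nonneg _).trans (hK5 0 u a b c d)
  have hρ0d : ∀ x y, 0 < ρ x y := fun x y => lt_of_lt_of_le one_pos (hρ1 x y)
  have hr0d : ∀ x y, 0 < r₁ x y := fun x y => lt_of_lt_of_le one_pos (hr₁1 x y)
  have hϑ0 : ∀ a b, 0 ≤ ϑ a b := fun a b => zero_le_one.trans (hϑ1 a b)
  refine le_trans (Finset.sum_le_sum fun x _ => Finset.sum_le_sum fun y _ => Finset.sum_le_sum fun z _ => Finset.sum_le_sum fun t _ =>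
    mul_le_mul_of_nonneg_right
        (interpolated_fifth_kernel_entry hΓop Y hUd hU'd hU''d hU₃d hU₄d hU₅c hκ₀ hκ₁ ha hτ hδ hθ0 hθ1 hκθ hκθw hstab hU'b hU''b hU₃b hU₄b hU₅b hlam hUsec hρg hHk hHk0 hK3 hK30 hK4 hK40 hK5 hhr ψ hαr hαc hlamA hlamA1 hγ hγ1 hD hDC
          hθnn hDθr hdθ hDθc hdθ' hσ0 hσθ hρ1 hρsymm hρmul hρσ hr1 hrσ haσ hβ haσ' hgσ hgσ' hkσ hkσ' hC3k hC3h hC4 hC5 hr₁1 hr₁symm hr₁mul hr₁8 hC40 hC50 x y z t s)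
        (mul_nonneg (mul_nonneg (mul_nonneg (mul_nonneg (mul_nonneg (mul_nonneg (mul_nonneg (mul_nonneg (mul_nonneg (hϑ0 x y) (hϑ0 x z)) (hϑ0 x t)) (hϑ0 x s)) (hϑ0 y z)) (hϑ0 y t)) (hϑ0 y s)) (hϑ0 z t)) (hϑ0 z s)) (hϑ0 t s))) ?_
  exact output_k5ϑ_s hK50d hK40 hK30 hHk0 hD hlamA1 hθnn hDθr hdθ hDθc hdθ' hσ0 hσθ hϑ1 hϑsymm hϑmul hϑ4 hϑ₂symm hϑσ6 hρ0d hρsymm hr0d hr₁symm hϑr₁ hC50 hG hΘ hS2 hhrw hhc hk3m hk3c haσ hbσc hαθc hg2m hg1c hαg1c hk4m3 hk4c hαk4c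
      hk5m4 hk5c hαk5c hk5 s

/-! ## Toy -/

/-- Toy (the composition step on numbers): `|e| ≤ m` and `w ≥ 0` give `|e|·w ≤ m·w`. -/
example (e m w : ℝ) (h : |e| ≤ m) (hw : 0 ≤ w) : |e| * w ≤ m * w := mul_le_mul_of_nonneg_right h hw

end Summit.QuantumFields.BalabanUV.T4Continuum.NE7b.SupWeightedFifthOrderOutputFive

end
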